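import Summits.QuantumFields.YangMills.Theorems.SwapVirialDeficitSwapRingLogFreeFloor
import Summits.QuantumFields.YangMills.Theorems.SwapVirialDeficitSwapRingLogDerivDeficit
import Summits.QuantumFields.YangMills.Theorems.SwapVirialDeficitLogTwistTraceConvex
import Summits.QuantumFields.YangMills.Theorems.VirialFluxGapLogSectorWeightConvex
import Summits.QuantumFields.YangMills.Theorems.BalabanUVNodesPortZDPencilFTC
import Mathlib.Analysis.Convex.Deriv
import HarnessLib

/-!
# The thermodynamic sandwich and a WINDOW-UNIFORM a-priori ceiling on the σ-glued mean deficit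

The virial form of the window row (fcl-p3 memo2 (V3′), ✓`virial_decomposition`) contains `½⟨W⟩_b`; the followers' half is pointwise
`≤ 13824·L^{10}·F̂` (✓`sum_gnomonicW_followers_le_pow_ten`), so it is controlled by an A-PRIORI bound on the mean deficit `⟨F⟩_b` that is UNIFORM IN `L`.
Such a bound is free from convexity of `b ↦ log ∫ e^{−bF} dμ_L` ("thermodynamic sandwich") and the explicit Laplace floor already in the tree:

* §1 (generic probability space, bounded measurable `F`): `convexOn_log_integral_exp_mul`, ★★ `mul_gibbsMean_le_two_mul_log_sub`
  (`b⟨F⟩_b ≤ 2(log Z(b/2) − log Z(b))`), ★★ `log_sub_le_mul_gibbsMean` (`log Z(b) − log Z(2b) ≤ b⟨F⟩_b`), `log_integral_exp_neg_mul_nonpos`,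
  ★ `mul_gibbsMean_le_of_laplace_floor` (`F ≥ 0`, `e^{−A} ≤ Z(b)` ⟹ `b⟨F⟩_b ≤ 2A`) — Mathlib `ConvexOn.deriv_le_slope` ∕ `slope_le_deriv` on the cgf
  (✓`convexOn_cgf_of_bounded`, ✓`PortZD.hasDerivAt_log_integral_exp_mul_of_ae_bound`);
* (§2 = ✓`exists_abs_swapRingDeficit_le` of fcl-p3 g46's `…SwapRingLogDerivDeficit`, imported);
* §3 `neg_log_floor_le` (arithmetic of the floor constant), ★★★ `swap_meanDeficit_apriori` — ABSOLUTE `K ≥ 0`, `β₀ ≥ 1` with, for EVERY `L ≥ 1` and `b ≥ β₀`,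
  `b·⟨F^S_0⟩_b ≤ 2(9L⁴ − 1)·log b + K·L⁴·(1 + log L)` (✓`swap_laplace_floor_of_leaderVolume` with the universal constants of ✓`swapCommVolume`);
* §4 `differentiableAt_log_twistTrace`, `twistTrace_le_exp` (`Z^S ≤ e^{12bL⁴}`), ★★★ `swap_meanAction_apriori` — the same for the full trace:
  `12βL⁴ − β·(log Z^S(L,·,2L))′(β) ≤ 2(9L⁴ − 1)·log β + K·L⁴·(1 + log L) + 2 log 8`, every `L`, `β ≥ β₀` (✓`logTwistTraceConvex`,
  ✓`swap_twistTrace_floor_of_leaderVolume`).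

HONEST LABEL: a CRUDE a-priori ceiling (`O(L⁴ log β)` where ⟨24197⟩ needs `9L⁴ − 3/2 + c` as a FLOOR and ⟨24196⟩-type rows need `O(1)` precision) —
window-uniform bookkeeping for the DRAFT virial line, not an estimate on the crux; ⟨24197⟩ (window-uniform) ∕ ⟨24194⟩ ∕ ⟨24497⟩ OPEN; own crux
⟨22884⟩ OPEN (blocked-on ⟨19935⟩); no crux, rung of record or summit is proved; the Yang–Mills mass gap is NOT proved; no summit is proved by a line.
THEOREMS ONLY (0 `def`, 0 `sorry`), standard axioms.  Width seat ym-line-sfw-p2-w2 g57 (cell ym-idea-1, free hands), `--supports stmt-QuantumFields-24197`.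
References: [cite: Griffiths1964]; [cite: tHooft1979]; [cite: Luscher1983, §2]; [folklore].
-/

set_option autoImplicit false

noncomputable section

open MeasureTheory Set Filter
open scoped BigOperators Topology
open Literature.MathematicalPhysics.QuantumFieldTheory hiding SU2
open Literature.MathematicalPhysics.QuantumLattice

namespace Summit.QuantumFields.YangMills.Theorems.SwapVirialDeficit.SwapRing

open Summit.QuantumFields.YangMills.Theorems.FemtoTransferGap
open Summit.QuantumFields.YangMills.Theorems.FemtoTransferGap.TT
open Summit.QuantumFields.YangMills.Theorems.FemtoTransferGap.TT.SectorSmooth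
open Summit.QuantumFields.YangMills.Theorems.VirialFluxGap.RingDeficit
open Summit.QuantumFields.YangMills.Theorems.PortZD (hasDerivAt_log_integral_exp_mul_of_ae_bound integrable_exp_mul_of_ae_bound)

/-! ## §1 Generic: the thermodynamic sandwich for a Laplace transform -/

section Sandwich

variable {X : Type*} [MeasurableSpace X] (μ : Measure X) [IsProbabilityMeasure μ] {F : X → ℝ} {M : ℝ}

/-- `s ↦ log ∫ e^{sF} dμ` is convex on `ℝ` for bounded measurable `F` (✓`convexOn_cgf_of_bounded`). [cite: Griffiths1964] -/
theorem convexOn_log_integral_exp_mul (hF : Measurable F) (hbd : ∀ x, |F x| ≤ M) :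
    ConvexOn ℝ univ (fun s : ℝ => Real.log (∫ x, Real.exp (s * F x) ∂μ)) :=
  convexOn_cgf_of_bounded μ hF hbd

/-- ★★ **THERMODYNAMIC SANDWICH, upper half**: for bounded measurable `F` on a probability space and `b > 0`, the Gibbs mean
`⟨F⟩_b = ∫ F e^{−bF} ∕ ∫ e^{−bF}` obeys `b·⟨F⟩_b ≤ 2·(log Z(b/2) − log Z(b))`, `Z(t) = ∫ e^{−tF} dμ` (convexity of `log Z`: `t ↦ ⟨F⟩_t` is
decreasing). [cite: Griffiths1964] -/
theorem mul_gibbsMean_le_two_mul_log_sub (hF : Measurable F) (hbd : ∀ x, |F x| ≤ M) {b : ℝ} (hb : 0 < b) :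
    b * ((∫ x, F x * Real.exp (-b * F x) ∂μ) / ∫ x, Real.exp (-b * F x) ∂μ) ≤
      2 * (Real.log (∫ x, Real.exp (-(b / 2) * F x) ∂μ) - Real.log (∫ x, Real.exp (-b * F x) ∂μ)) := by
  have hgc := convexOn_log_integral_exp_mul μ hF hbd
  have hd := hasDerivAt_log_integral_exp_mul_of_ae_bound (μ := μ) hF.aestronglyMeasurable (ae_of_all _ hbd) (-b)
  have h := hgc.deriv_le_slope (mem_univ (-b)) (mem_univ (-(b / 2))) (by linarith : -b < -(b / 2)) hd.differentiableAt
  rw [hd.deriv, slope_def_field, show -(b / 2) - -b = b / 2 by ring, le_div_iff₀ (by linarith : (0:ℝ) < b / 2)] at h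
  linarith

/-- ★★ **THERMODYNAMIC SANDWICH, lower half**: `log Z(b) − log Z(2b) ≤ b·⟨F⟩_b`. [cite: Griffiths1964] -/
theorem log_sub_le_mul_gibbsMean (hF : Measurable F) (hbd : ∀ x, |F x| ≤ M) {b : ℝ} (hb : 0 < b) :
    Real.log (∫ x, Real.exp (-b * F x) ∂μ) - Real.log (∫ x, Real.exp (-(2 * b) * F x) ∂μ) ≤
      b * ((∫ x, F x * Real.exp (-b * F x) ∂μ) / ∫ x, Real.exp (-b * F x) ∂μ) := by
  have hgc := convexOn_log_integral_exp_mul μ hF hbd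
  have hd := hasDerivAt_log_integral_exp_mul_of_ae_bound (μ := μ) hF.aestronglyMeasurable (ae_of_all _ hbd) (-b)
  have h := hgc.slope_le_deriv (mem_univ (-(2 * b))) (mem_univ (-b)) (by linarith : -(2 * b) < -b) hd.differentiableAt
  rw [hd.deriv, slope_def_field, show -b - -(2 * b) = b by ring, div_le_iff₀ hb] at h
  linarith

/-- For `F ≥ 0` and `t ≥ 0`, `log Z(t) ≤ 0` on a probability space. [folklore] -/
theorem log_integral_exp_neg_mul_nonpos (hF : Measurable F) (hbd : ∀ x, |F x| ≤ M) (h0 : ∀ x, 0 ≤ F x) {t : ℝ} (ht : 0 ≤ t) :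
    Real.log (∫ x, Real.exp (-t * F x) ∂μ) ≤ 0 := by
  refine Real.log_nonpos (integral_nonneg fun x => (Real.exp_pos _).le) ?_
  calc ∫ x, Real.exp (-t * F x) ∂μ ≤ ∫ _x, (1 : ℝ) ∂μ :=
        integral_mono (integrable_exp_mul_of_ae_bound hF.aestronglyMeasurable (ae_of_all _ hbd) (-t)) (integrable_const 1)
          fun x => Real.exp_le_one_iff.2 (by nlinarith [h0 x])
    _ = 1 := by simp

/-- ★ **A-PRIORI CEILING FROM A LAPLACE FLOOR**: `F ≥ 0` bounded, `b > 0`, and `e^{−A} ≤ Z(b)` ⟹ `b·⟨F⟩_b ≤ 2A`. [cite: Griffiths1964] -/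
theorem mul_gibbsMean_le_of_laplace_floor (hF : Measurable F) (hbd : ∀ x, |F x| ≤ M) (h0 : ∀ x, 0 ≤ F x) {b A : ℝ} (hb : 0 < b)
    (hfloor : Real.exp (-A) ≤ ∫ x, Real.exp (-b * F x) ∂μ) :
    b * ((∫ x, F x * Real.exp (-b * F x) ∂μ) / ∫ x, Real.exp (-b * F x) ∂μ) ≤ 2 * A := by
  have h1 := mul_gibbsMean_le_two_mul_log_sub μ hF hbd hb
  have h2 := log_integral_exp_neg_mul_nonpos μ hF hbd h0 (t := b / 2) (by linarith)
  have h3 : -A ≤ Real.log (∫ x, Real.exp (-b * F x) ∂μ) := by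
    rw [← Real.log_exp (-A)]
    exact Real.log_le_log (Real.exp_pos _) hfloor
  linarith

end Sandwich

variable {L : ℕ} [NeZero L]

/-! ## §3 The window-uniform a-priori ceiling on the principal-sector mean deficit -/

/-- Arithmetic of the floor constant: for `L ≥ 1`, `b ≥ 1`, `0 < c`,
`−log(e^{−1}·c·(1/34)^{6L⁴−3}·((1200L⁴b)^{9L⁴−1})⁻¹) ≤ (9L⁴ − 1)·log b + (1 + |log c| + 6·log 34 + 9·log 1200 + 36)·L⁴·(1 + log L)`. [folklore] -/
theorem neg_log_floor_le {c : ℝ} (hc : 0 < c) {b : ℝ} (hb : 1 ≤ b) :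
    -Real.log (Real.exp (-1) * (c * (1 / 34 : ℝ) ^ (6 * L ^ 4 - 3) * ((1200 * (L : ℝ) ^ 4 * b) ^ (9 * L ^ 4 - 1))⁻¹)) ≤
      (9 * (L : ℝ) ^ 4 - 1) * Real.log b + (1 + |Real.log c| + 6 * Real.log 34 + 9 * Real.log 1200 + 36) * (L : ℝ) ^ 4 * (1 + Real.log L) := by
  have hL : (1 : ℝ) ≤ L := by exact_mod_cast NeZero.one_le
  have hL4 : (1 : ℝ) ≤ (L : ℝ) ^ 4 := one_le_pow₀ hL
  have hlogL : 0 ≤ Real.log L := Real.log_nonneg hL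
  have hlogb : 0 ≤ Real.log b := Real.log_nonneg hb
  have h34 : 0 < Real.log 34 := Real.log_pos (by norm_num)
  have h1200 : 0 < Real.log 1200 := Real.log_pos (by norm_num)
  have hKb : 0 < 1200 * (L : ℝ) ^ 4 * b := by positivity
  have hn1 : ((6 * L ^ 4 - 3 : ℕ) : ℝ) ≤ 6 * (L : ℝ) ^ 4 := by
    have : ((6 * L ^ 4 - 3 : ℕ) : ℝ) ≤ ((6 * L ^ 4 : ℕ) : ℝ) := by exact_mod_cast Nat.sub_le _ _
    simpa using this
  have hn2 : ((9 * L ^ 4 - 1 : ℕ) : ℝ) = 9 * (L : ℝ) ^ 4 - 1 := by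
    have h1 : 1 ≤ 9 * L ^ 4 := by have := Nat.one_le_pow 4 L NeZero.one_le; omega
    rw [Nat.cast_sub h1]; push_cast; ring
  rw [Real.log_mul (Real.exp_pos _).ne' (by positivity), Real.log_exp, Real.log_mul (by positivity) (by positivity),
    Real.log_mul hc.ne' (by positivity), Real.log_inv, Real.log_pow, Real.log_pow, hn2,
    Real.log_mul (by positivity) (by positivity), Real.log_mul (by norm_num) (by positivity), Real.log_pow,
    one_div, Real.log_inv]
  have hc' : -Real.log c ≤ |Real.log c| := neg_le_abs _
  have e1 : ((6 * L ^ 4 - 3 : ℕ) : ℝ) * Real.log 34 ≤ 6 * (L : ℝ) ^ 4 * Real.log 34 := mul_le_mul_of_nonneg_right hn1 h34.le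
  have hL40 : (0 : ℝ) ≤ (L : ℝ) ^ 4 := zero_le_one.trans hL4
  push_cast
  nlinarith [mul_nonneg (mul_nonneg (abs_nonneg (Real.log c)) hL40) hlogL, mul_nonneg (mul_nonneg h34.le hL40) hlogL,
    mul_nonneg (mul_nonneg h1200.le hL40) hlogL, mul_nonneg hL40 hlogL, mul_nonneg hL40 hlogb,
    mul_nonneg (abs_nonneg (Real.log c)) (by linarith : (0:ℝ) ≤ (L : ℝ) ^ 4 - 1), hc', e1, h34.le, h1200.le, hlogL, hlogb]

/-- ★★★ **WINDOW-UNIFORM A-PRIORI CEILING ON THE σ-GLUED PRINCIPAL-SECTOR MEAN DEFICIT**: there are ABSOLUTE constants `K, β₀ ≥ 1` such that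
for EVERY `L ≥ 1` and every `b ≥ β₀`,
`b·⟨F^S_0⟩_b ≤ 2(9L⁴ − 1)·log b + K·L⁴·(1 + log L)`,  `⟨F⟩_b = ∫ F e^{−bF} dμ_L ∕ ∫ e^{−bF} dμ_L`
(thermodynamic sandwich + ✓`swap_laplace_floor_of_leaderVolume` with the universal constants of ✓`swapCommVolume`).  The crux ⟨24197⟩ pins `b⟨F⟩_b`
to `9L⁴ − 1 ± O(1)`; this crude ceiling is `O(L⁴ log b)` but holds uniformly in `L` with no window condition — it is the input that makes the
followers' virial correction `½⟨W_F⟩_b ≤ 13824·L^{10}·⟨F⟩_b` (✓`sum_gnomonicW_followers_le_pow_ten`) harmless on every window `L ≤ b^a`.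
[cite: Griffiths1964] [cite: Luscher1983, §2] [cite: tHooft1979] -/
theorem swap_meanDeficit_apriori :
    ∃ K : ℝ, 0 ≤ K ∧ ∃ β₀ : ℝ, 1 ≤ β₀ ∧ ∀ (L : ℕ) [NeZero L] (b : ℝ), β₀ ≤ b →
      b * ((∫ p, swapRingDeficit L (fun _ => false) p * Real.exp (-b * swapRingDeficit L (fun _ => false) p) ∂(ringMeasure L)) /
          ∫ p, Real.exp (-b * swapRingDeficit L (fun _ => false) p) ∂(ringMeasure L)) ≤
        2 * (9 * (L : ℝ) ^ 4 - 1) * Real.log b + K * (L : ℝ) ^ 4 * (1 + Real.log L) := by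
  obtain ⟨c, hc, s₀, hs₀, hs₀1, hvol⟩ := swapCommVolume
  refine ⟨2 * (1 + |Real.log c| + 6 * Real.log 34 + 9 * Real.log 1200 + 36), by positivity, max 1 (1200 * s₀ ^ 2)⁻¹, le_max_left _ _,
    fun L _ b hb => ?_⟩
  haveI := isProbabilityMeasure_ringMeasure (L := L)
  have hb1 : 1 ≤ b := (le_max_left _ _).trans hb
  have hb0 : 0 < b := by linarith
  have hL : (1 : ℝ) ≤ L := by exact_mod_cast NeZero.one_le
  have hL4 : (1 : ℝ) ≤ (L : ℝ) ^ 4 := one_le_pow₀ hL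
  have hβ₀ : (1200 * (L : ℝ) ^ 4 * s₀ ^ 2)⁻¹ ≤ b := by
    refine le_trans ?_ ((le_max_right _ _).trans hb)
    exact inv_anti₀ (by positivity) (by nlinarith [sq_nonneg s₀, mul_pos (by norm_num : (0:ℝ) < 1200) (pow_pos hs₀ 2)])
  have hfloor := swap_laplace_floor_of_leaderVolume (L := L) hs₀ hs₀1 hvol hb1 hβ₀
  obtain ⟨M, hM⟩ := exists_abs_swapRingDeficit_le (L := L) (fun _ => false)
  have hfloor' : Real.exp (-(-Real.log (Real.exp (-1) * (c * (1 / 34 : ℝ) ^ (6 * L ^ 4 - 3) * ((1200 * (L : ℝ) ^ 4 * b) ^ (9 * L ^ 4 - 1))⁻¹)))) ≤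
      ∫ p, Real.exp (-b * swapRingDeficit L (fun _ => false) p) ∂(ringMeasure L) := by
    rw [neg_neg, Real.exp_log (by positivity)]
    refine hfloor.trans (le_of_eq (integral_congr_ae (ae_of_all _ fun p => ?_)))
    show Real.exp (-(b * swapRingDeficit L (fun _ => false) p)) = Real.exp (-b * swapRingDeficit L (fun _ => false) p)
    rw [neg_mul]
  have h := mul_gibbsMean_le_of_laplace_floor (ringMeasure L) (measurable_swapRingDeficit _) hM (swapRingDeficit_nonneg (L := L) _) hb0 hfloor'
  have hK := neg_log_floor_le (L := L) hc hb1
  linarith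

/-! ## §4 The same ceiling for the full σ-glued trace (all sectors) -/

/-- `b ↦ log Z^S(L,b,2L)` is differentiable. [cite: tHooft1979] -/
theorem differentiableAt_log_twistTrace (b : ℝ) : DifferentiableAt ℝ (fun t : ℝ => Real.log (TT.twistTrace L t (2 * L))) b := by
  have h : DifferentiableAt ℝ (fun t : ℝ => twistTraceSucc L t (2 * L - 1)) b := (differentiable_twistTraceSucc (L := L) (2 * L - 1)) b
  exact h.log (twistTraceSucc_pos (L := L) b _).ne'

/-- The trivial ceiling `Z^S(L,b,2L) ≤ e^{12bL⁴}` for `b ≥ 0` (each sector Laplace integral is `≤ 1`). [cite: tHooft1979] -/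
theorem twistTrace_le_exp {b : ℝ} (hb : 0 ≤ b) : TT.twistTrace L b (2 * L) ≤ Real.exp (12 * b * (L : ℝ) ^ 4) := by
  haveI := isProbabilityMeasure_ringMeasure (L := L)
  rw [twistTrace_eq_sum_exp_mul_integral_deficit]
  have hz : ∀ z : Fin 3 → Bool, ∫ p, Real.exp (-(b * swapRingDeficit L z p)) ∂(ringMeasure L) ≤ 1 := fun z => by
    obtain ⟨M, hM⟩ := exists_abs_swapRingDeficit_le (L := L) z
    calc ∫ p, Real.exp (-(b * swapRingDeficit L z p)) ∂(ringMeasure L) ≤ ∫ _p, (1 : ℝ) ∂(ringMeasure L) := by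
          refine integral_mono ?_ (integrable_const 1) fun p => Real.exp_le_one_iff.2 (by nlinarith [swapRingDeficit_nonneg (L := L) z p])
          have hi := integrable_exp_mul_of_ae_bound (μ := ringMeasure L) (measurable_swapRingDeficit z).aestronglyMeasurable (ae_of_all _ hM) (-b)
          exact hi.congr (ae_of_all _ fun p => by simp [neg_mul])
      _ = 1 := by simp
  calc (1 / 8 : ℝ) * ∑ z : Fin 3 → Bool, Real.exp (12 * b * (L : ℝ) ^ 4) * ∫ p, Real.exp (-(b * swapRingDeficit L z p)) ∂(ringMeasure L)
      ≤ (1 / 8 : ℝ) * ∑ _z : Fin 3 → Bool, Real.exp (12 * b * (L : ℝ) ^ 4) * 1 := by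
        gcongr with z
        exact hz z
    _ = Real.exp (12 * b * (L : ℝ) ^ 4) := by
        rw [Finset.sum_const, Finset.card_univ, Fintype.card_fun, Fintype.card_bool, Fintype.card_fin, nsmul_eq_mul]
        norm_num
        ring

/-- ★★★ **WINDOW-UNIFORM A-PRIORI CEILING ON THE σ-GLUED MEAN ACTION** (all sectors): with the SAME absolute `K, β₀`, for every `L ≥ 1` and `β ≥ β₀`,
`12βL⁴ − β·(d/dβ) log Z^S(L,β,2L) ≤ 2(9L⁴ − 1)·log β + (K·L⁴·(1 + log L) + 2·log 8)`
(convexity ✓`logTwistTraceConvex`: `β f'(β) ≥ 2(f(β) − f(β/2))`; floor ✓`swap_twistTrace_floor_of_leaderVolume`; ceiling `twistTrace_le_exp`).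
The crux ⟨24197⟩ asks for the FLOOR `≥ 9L⁴ − 3/2 + c` of the same quantity on a window; this is the crude universal ceiling. [cite: tHooft1979] [cite: Griffiths1964] -/
theorem swap_meanAction_apriori :
    ∃ K : ℝ, 0 ≤ K ∧ ∃ β₀ : ℝ, 1 ≤ β₀ ∧ ∀ (L : ℕ) [NeZero L] (β : ℝ), β₀ ≤ β →
      12 * β * (L : ℝ) ^ 4 - β * deriv (fun b : ℝ => Real.log (TT.twistTrace L b (2 * L))) β ≤
        2 * (9 * (L : ℝ) ^ 4 - 1) * Real.log β + (K * (L : ℝ) ^ 4 * (1 + Real.log L) + 2 * Real.log 8) := by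
  obtain ⟨c, hc, s₀, hs₀, hs₀1, hvol⟩ := swapCommVolume
  refine ⟨2 * (1 + |Real.log c| + 6 * Real.log 34 + 9 * Real.log 1200 + 36), by positivity, max 2 (2 * (1200 * s₀ ^ 2)⁻¹),
    (by norm_num : (1:ℝ) ≤ 2).trans (le_max_left _ _), fun L _ β hβ => ?_⟩
  have hβ2 : 2 ≤ β := (le_max_left _ _).trans hβ
  have hβ1 : 1 ≤ β := by linarith
  have hβ0 : 0 < β := by linarith
  have hL : (1 : ℝ) ≤ L := by exact_mod_cast NeZero.one_le
  have hL4 : (1 : ℝ) ≤ (L : ℝ) ^ 4 := one_le_pow₀ hL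
  have hβ₀ : (1200 * (L : ℝ) ^ 4 * s₀ ^ 2)⁻¹ ≤ β := by
    have h1 : (1200 * (L : ℝ) ^ 4 * s₀ ^ 2)⁻¹ ≤ (1200 * s₀ ^ 2)⁻¹ :=
      inv_anti₀ (by positivity) (by nlinarith [sq_nonneg s₀, mul_pos (by norm_num : (0:ℝ) < 1200) (pow_pos hs₀ 2)])
    have h2 : (1200 * s₀ ^ 2)⁻¹ ≤ 2 * (1200 * s₀ ^ 2)⁻¹ := le_mul_of_one_le_left (by positivity) (by norm_num)
    exact h1.trans (h2.trans ((le_max_right _ _).trans hβ))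
  -- convexity: β f'(β) ≥ 2 (f β − f (β/2))
  have hfc := logTwistTraceConvex L (2 * L)
  have hsl := hfc.slope_le_deriv (mem_univ (β / 2)) (mem_univ β) (by linarith : β / 2 < β) (differentiableAt_log_twistTrace (L := L) β)
  rw [slope_def_field, show β - β / 2 = β / 2 by ring, div_le_iff₀ (by linarith : (0:ℝ) < β / 2)] at hsl
  -- floor at β, ceiling at β/2
  have hfloor := swap_twistTrace_floor_of_leaderVolume (L := L) hs₀ hs₀1 hvol hβ1 hβ₀
  have hceil := twistTrace_le_exp (L := L) (b := β / 2) (by linarith)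
  have hpos : 0 < Real.exp (-1) * (c * (1 / 34 : ℝ) ^ (6 * L ^ 4 - 3) * ((1200 * (L : ℝ) ^ 4 * β) ^ (9 * L ^ 4 - 1))⁻¹) := by positivity
  have hlogfloor : Real.log (1 / 8 : ℝ) + 12 * β * (L : ℝ) ^ 4 +
      Real.log (Real.exp (-1) * (c * (1 / 34 : ℝ) ^ (6 * L ^ 4 - 3) * ((1200 * (L : ℝ) ^ 4 * β) ^ (9 * L ^ 4 - 1))⁻¹)) ≤
        Real.log (TT.twistTrace L β (2 * L)) := by
    have h := Real.log_le_log (by positivity) hfloor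
    rwa [Real.log_mul (by norm_num) (by positivity), Real.log_mul (Real.exp_pos _).ne' hpos.ne', Real.log_exp, ← add_assoc] at h
  have hlogceil : Real.log (TT.twistTrace L (β / 2) (2 * L)) ≤ 12 * (β / 2) * (L : ℝ) ^ 4 := by
    have h := Real.log_le_log (twistTraceSucc_pos (L := L) (β / 2) _) hceil
    rwa [Real.log_exp] at h
  have hK := neg_log_floor_le (L := L) hc hβ1
  have h8 : Real.log (1 / 8 : ℝ) = -Real.log 8 := by rw [one_div, Real.log_inv]
  rw [h8] at hlogfloor
  nlinarith [hsl, hlogfloor, hlogceil, hK, hβ0]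

end Summit.QuantumFields.YangMills.Theorems.SwapVirialDeficit.SwapRing

end
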